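import Mathlib
import HarnessLib.Audit
import HarnessLib

/-!
# L3TimeExponentPincer — layer cake: a weak-`L^{3/2}` bound and an `L²` floor force an `L³` floor

Support kernel for the crux `L3CascadeJaw` (route `L3TimeExponentPincer`, item
stmt-NavierStokesRegularity-19499), first half of the kinematic `L³` floor
`‖v‖₂² ≤ C ‖curl v‖₁ ‖v‖₃` serving the PERSISTENCE LEMMA `LpPersistence 3 (1/2) 2` of
`L3TimeExponentPincerQuantJaw` (ROUND-11 of seat nsreg-p2, "the jaw has no constant"; steps
(iv)–(vi) of its paper proof, here WITHOUT Hardy–Littlewood–Sobolev). Pure measure theory on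
`ℝ³`, for a measurable vector field `f`:

* `meas_gt_mul_cube_le` — Chebyshev in `L³`: `|{‖f‖ > t}| t³ ≤ ∫|f|³`;
* `lintegral_sq_eq_layerCake` — `∫|f|² = 2∫₀^∞ t |{‖f‖ > t}| dt`;
* `lintegral_sq_le_split_of_weak` — if `|{‖f‖ > t}| ≤ D t^{-3/2}` for all `t > 0` then for every
  split level `Λ > 0`: `∫|f|² ≤ 4D√Λ + 2Λ⁻¹∫|f|³` (real interpolation
  `(L^{3/2,∞}, L³)_{1/2} ⊃ L²` with constants);
* `lintegral_cube_ge_of_weak` — FLOOR form: `∫|f|² ≥ X > 0` forces `∫|f|³ ≥ X³/(256 D²)`.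

The weak bound is supplied for Biot–Savart velocities (`D = (2/√(2π)) ‖curl v‖₁^{3/2}`) in the
companion file `L3TimeExponentPincerVorticityL3Floor`. WHAT THIS IS NOT: no fluid mechanics here.
-/

namespace Summit.NavierStokesRegularity.NavierStokesRegularity.Theorems.L3TimeExponentPincerWeakLayerCake

open MeasureTheory Set Metric Real
open scoped ENNReal NNReal

/-! ### §1  Layer cake: from weak-`L^{3/2}` and `L³` to `L²` -/

/-- **Chebyshev in `L³`**: `|{‖f‖ > t}| · t³ ≤ ∫|f|³` (`t > 0`). -/
theorem meas_gt_mul_cube_le {f : (EuclideanSpace ℝ (Fin 3)) → (EuclideanSpace ℝ (Fin 3))} (hf : AEStronglyMeasurable f volume) {t : ℝ}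
    (ht : 0 < t) :
    volume {x | t < ‖f x‖} * ENNReal.ofReal (t ^ 3) ≤ ∫⁻ x, ‖f x‖ₑ ^ (3 : ℕ) := by
  have hsub : {x | t < ‖f x‖} ⊆ {x | ENNReal.ofReal (t ^ 3) ≤ ‖f x‖ₑ ^ (3 : ℕ)} := by
    intro x hx
    simp only [mem_setOf_eq] at hx ⊢
    rw [← ofReal_norm, ← ENNReal.ofReal_pow (norm_nonneg _)]
    exact ENNReal.ofReal_le_ofReal (pow_le_pow_left₀ ht.le hx.le 3)
  have hmeas : AEMeasurable (fun x => ‖f x‖ₑ ^ (3 : ℕ)) volume := hf.enorm.pow_const 3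
  calc volume {x | t < ‖f x‖} * ENNReal.ofReal (t ^ 3)
      ≤ volume {x | ENNReal.ofReal (t ^ 3) ≤ ‖f x‖ₑ ^ (3 : ℕ)} * ENNReal.ofReal (t ^ 3) := by
        gcongr
    _ = ENNReal.ofReal (t ^ 3) * volume {x | ENNReal.ofReal (t ^ 3) ≤ ‖f x‖ₑ ^ (3 : ℕ)} :=
        mul_comm _ _
    _ ≤ ∫⁻ x, ‖f x‖ₑ ^ (3 : ℕ) := mul_meas_ge_le_lintegral₀ hmeas _

/-- **Layer cake in `L²`**: `∫|f|² = 2 ∫₀^∞ t · |{‖f‖ > t}| dt`. -/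
theorem lintegral_sq_eq_layerCake {f : (EuclideanSpace ℝ (Fin 3)) → (EuclideanSpace ℝ (Fin 3))} (hf : AEStronglyMeasurable f volume) :
    ∫⁻ x, ‖f x‖ₑ ^ 2 =
      ENNReal.ofReal 2 * ∫⁻ t in Ioi (0 : ℝ), volume {x | t < ‖f x‖} * ENNReal.ofReal t := by
  have h := lintegral_rpow_eq_lintegral_meas_lt_mul volume (f := fun x => ‖f x‖)
    (Filter.Eventually.of_forall fun x => norm_nonneg (f x)) hf.norm.aemeasurable (p := 2)
    (by norm_num)
  have hL : ∫⁻ x, ‖f x‖ₑ ^ 2 = ∫⁻ x, ENNReal.ofReal (‖f x‖ ^ (2 : ℝ)) := by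
    refine lintegral_congr fun x => ?_
    rw [← ofReal_norm, ← ENNReal.ofReal_pow (norm_nonneg _), Real.rpow_two]
  rw [hL, h]
  congr 1
  refine setLIntegral_congr_fun measurableSet_Ioi fun t _ => ?_
  congr 2
  norm_num

/-- **The two-parameter bound**: if `|{‖f‖ > t}| ≤ D t^{-3/2}` for all `t > 0` (`D ≥ 0`), then
for every split level `Λ > 0`, `∫|f|² ≤ 4 D √Λ + 2 Λ⁻¹ ∫|f|³` (small levels by the weak bound,
`∫₀^Λ t · D t^{-3/2} dt = 2D√Λ`; large levels by Chebyshev in `L³`, `∫_Λ^∞ t · t⁻³ dt = Λ⁻¹`). -/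
theorem lintegral_sq_le_split_of_weak {f : (EuclideanSpace ℝ (Fin 3)) → (EuclideanSpace ℝ (Fin 3))} (hf : AEStronglyMeasurable f volume)
    {D : ℝ} (hD : 0 ≤ D)
    (hweak : ∀ t : ℝ, 0 < t → volume {x | t < ‖f x‖} ≤ ENNReal.ofReal (D * t ^ (-(3 / 2 : ℝ))))
    {Λ : ℝ} (hΛ : 0 < Λ) :
    ∫⁻ x, ‖f x‖ₑ ^ 2 ≤
      ENNReal.ofReal (4 * D * Real.sqrt Λ) + ENNReal.ofReal (2 * Λ⁻¹) * ∫⁻ x, ‖f x‖ₑ ^ (3 : ℕ) := by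
  set B : ℝ≥0∞ := ∫⁻ x, ‖f x‖ₑ ^ (3 : ℕ) with hB
  set G : ℝ → ℝ≥0∞ := fun t => volume {x | t < ‖f x‖} * ENNReal.ofReal t with hG
  -- small levels: `G t ≤ D t^{-1/2}`
  have hsmall : ∀ t ∈ Ioc (0 : ℝ) Λ, G t ≤ ENNReal.ofReal (D * t ^ (-(1 / 2 : ℝ))) := by
    intro t ht
    have ht0 : 0 < t := ht.1
    calc G t ≤ ENNReal.ofReal (D * t ^ (-(3 / 2 : ℝ))) * ENNReal.ofReal t := by
          show volume {x | t < ‖f x‖} * ENNReal.ofReal t ≤ _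
          exact mul_le_mul' (hweak t ht0) le_rfl
      _ = ENNReal.ofReal (D * t ^ (-(1 / 2 : ℝ))) := by
          rw [← ENNReal.ofReal_mul (mul_nonneg hD (Real.rpow_nonneg ht0.le _))]
          congr 1
          have e : t ^ (-(1 / 2 : ℝ)) = t ^ (-(3 / 2 : ℝ)) * t := by
            conv_rhs => rw [show t ^ (-(3 / 2 : ℝ)) * t = t ^ (-(3 / 2 : ℝ)) * t ^ (1 : ℝ) by
              rw [Real.rpow_one], ← Real.rpow_add ht0]
            norm_num
          rw [e]
          ring
  -- large levels: `G t ≤ B t⁻²`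
  have hlarge : ∀ t ∈ Ioi Λ, G t ≤ B * ENNReal.ofReal (t ^ (-2 : ℝ)) := by
    intro t ht
    have ht0 : 0 < t := hΛ.trans ht
    have h1 := meas_gt_mul_cube_le hf ht0
    have ht3 : ENNReal.ofReal t = ENNReal.ofReal (t ^ 3) * ENNReal.ofReal (t ^ (-2 : ℝ)) := by
      rw [← ENNReal.ofReal_mul (by positivity)]
      congr 1
      rw [Real.rpow_neg ht0.le, Real.rpow_two]
      field_simp
    calc G t = volume {x | t < ‖f x‖} * ENNReal.ofReal (t ^ 3) * ENNReal.ofReal (t ^ (-2 : ℝ)) := by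
          rw [hG]
          simp only
          rw [ht3, mul_assoc]
      _ ≤ B * ENNReal.ofReal (t ^ (-2 : ℝ)) := by
          gcongr
  -- the head integral `∫₀^Λ D t^{-1/2} dt = 2 D √Λ`
  have hhead : ∫⁻ t in Ioc (0 : ℝ) Λ, ENNReal.ofReal (D * t ^ (-(1 / 2 : ℝ))) =
      ENNReal.ofReal (2 * D * Real.sqrt Λ) := by
    have hii : IntervalIntegrable (fun t : ℝ => t ^ (-(1 / 2 : ℝ))) volume 0 Λ :=
      intervalIntegral.intervalIntegrable_rpow' (by norm_num)
    have hint : IntegrableOn (fun t : ℝ => D * t ^ (-(1 / 2 : ℝ))) (Ioc 0 Λ) :=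
      (hii.1).const_mul D
    rw [← ofReal_integral_eq_lintegral_ofReal hint]
    · congr 1
      rw [integral_const_mul, ← intervalIntegral.integral_of_le hΛ.le,
        integral_rpow (Or.inl (by norm_num))]
      have e1 : Λ ^ (-(1 / 2 : ℝ) + 1) = Real.sqrt Λ := by
        rw [show (-(1 / 2 : ℝ) + 1) = 1 / 2 by norm_num, Real.sqrt_eq_rpow]
      have e2 : (0 : ℝ) ^ (-(1 / 2 : ℝ) + 1) = 0 := by
        rw [Real.zero_rpow (by norm_num)]
      rw [e1, e2]
      norm_num
      ring
    · exact (ae_restrict_iff' measurableSet_Ioc).2 (Filter.Eventually.of_forall fun t ht =>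
        mul_nonneg hD (Real.rpow_nonneg ht.1.le _))
  -- the tail integral `∫_Λ^∞ t⁻² dt = Λ⁻¹`
  have htail : ∫⁻ t in Ioi Λ, ENNReal.ofReal (t ^ (-2 : ℝ)) = ENNReal.ofReal Λ⁻¹ := by
    rw [← ofReal_integral_eq_lintegral_ofReal (integrableOn_Ioi_rpow_of_lt (by norm_num) hΛ)]
    · rw [integral_Ioi_rpow_of_lt (by norm_num) hΛ]
      congr 1
      norm_num
      rw [Real.rpow_neg_one]
    · exact (ae_restrict_iff' measurableSet_Ioi).2 (Filter.Eventually.of_forall fun t ht =>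
        Real.rpow_nonneg (hΛ.trans ht).le _)
  -- assemble
  rw [lintegral_sq_eq_layerCake hf, ← Ioc_union_Ioi_eq_Ioi hΛ.le,
    lintegral_union measurableSet_Ioi Ioc_disjoint_Ioi_same]
  have hI1 : ∫⁻ t in Ioc (0 : ℝ) Λ, G t ≤ ENNReal.ofReal (2 * D * Real.sqrt Λ) := by
    calc ∫⁻ t in Ioc (0 : ℝ) Λ, G t ≤ ∫⁻ t in Ioc (0 : ℝ) Λ, ENNReal.ofReal (D * t ^ (-(1 / 2 : ℝ))) :=
          setLIntegral_mono' measurableSet_Ioc hsmall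
      _ = ENNReal.ofReal (2 * D * Real.sqrt Λ) := hhead
  have hI2 : ∫⁻ t in Ioi Λ, G t ≤ B * ENNReal.ofReal Λ⁻¹ := by
    calc ∫⁻ t in Ioi Λ, G t ≤ ∫⁻ t in Ioi Λ, B * ENNReal.ofReal (t ^ (-2 : ℝ)) :=
          setLIntegral_mono' measurableSet_Ioi hlarge
      _ = B * ∫⁻ t in Ioi Λ, ENNReal.ofReal (t ^ (-2 : ℝ)) := by
          rw [lintegral_const_mul]
          exact (measurable_id.pow_const _).ennreal_ofReal
      _ = B * ENNReal.ofReal Λ⁻¹ := by rw [htail]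
  show ENNReal.ofReal 2 * ((∫⁻ t in Ioc (0 : ℝ) Λ, G t) + ∫⁻ t in Ioi Λ, G t) ≤ _
  calc ENNReal.ofReal 2 * ((∫⁻ t in Ioc (0 : ℝ) Λ, G t) + ∫⁻ t in Ioi Λ, G t)
      ≤ ENNReal.ofReal 2 * (ENNReal.ofReal (2 * D * Real.sqrt Λ) + B * ENNReal.ofReal Λ⁻¹) := by
        gcongr
    _ = ENNReal.ofReal (4 * D * Real.sqrt Λ) + ENNReal.ofReal (2 * Λ⁻¹) * B := by
        rw [show (4 : ℝ) * D * Real.sqrt Λ = 2 * (2 * D * Real.sqrt Λ) by ring,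
          ENNReal.ofReal_mul (by norm_num : (0 : ℝ) ≤ 2),
          ENNReal.ofReal_mul (by norm_num : (0 : ℝ) ≤ 2)]
        ring

/-- **The floor form**: under the weak bound `|{‖f‖ > t}| ≤ D t^{-3/2}` (`D > 0`), an energy
floor `∫|f|² ≥ X > 0` forces `∫|f|³ ≥ X³/(256 D²)` (the split level `Λ = (X/(8D))²` makes the
weak part `X/2`). -/
theorem lintegral_cube_ge_of_weak {f : (EuclideanSpace ℝ (Fin 3)) → (EuclideanSpace ℝ (Fin 3))} (hf : AEStronglyMeasurable f volume)
    {D : ℝ} (hD : 0 < D)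
    (hweak : ∀ t : ℝ, 0 < t → volume {x | t < ‖f x‖} ≤ ENNReal.ofReal (D * t ^ (-(3 / 2 : ℝ))))
    {X : ℝ} (hX : 0 < X) (hfloor : ENNReal.ofReal X ≤ ∫⁻ x, ‖f x‖ₑ ^ 2) :
    ENNReal.ofReal (X ^ 3 / (256 * D ^ 2)) ≤ ∫⁻ x, ‖f x‖ₑ ^ (3 : ℕ) := by
  set B : ℝ≥0∞ := ∫⁻ x, ‖f x‖ₑ ^ (3 : ℕ) with hB
  set Λ : ℝ := (X / (8 * D)) ^ 2 with hΛdef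
  have hΛ : 0 < Λ := by positivity
  have hsqrt : Real.sqrt Λ = X / (8 * D) := by
    rw [hΛdef, Real.sqrt_sq (by positivity)]
  have hsplit := lintegral_sq_le_split_of_weak hf hD.le hweak hΛ
  have e1 : 4 * D * Real.sqrt Λ = X / 2 := by
    rw [hsqrt]
    field_simp
    ring
  have e2 : 2 * Λ⁻¹ = 128 * D ^ 2 / X ^ 2 := by
    rw [hΛdef]
    field_simp
    ring
  rw [e1, e2] at hsplit
  -- `X = X/2 + X/2`, cancel `X/2`
  have hXsplit : ENNReal.ofReal X = ENNReal.ofReal (X / 2) + ENNReal.ofReal (X / 2) := by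
    rw [← ENNReal.ofReal_add (by positivity) (by positivity)]
    congr 1
    ring
  have hkey : ENNReal.ofReal (X / 2) ≤ ENNReal.ofReal (128 * D ^ 2 / X ^ 2) * B := by
    have h := hfloor.trans hsplit
    rw [hXsplit] at h
    exact (ENNReal.add_le_add_iff_left ENNReal.ofReal_ne_top).1 h
  -- divide by the (positive, finite) coefficient
  have hc : ENNReal.ofReal (128 * D ^ 2 / X ^ 2) ≠ 0 := by
    rw [ne_eq, ENNReal.ofReal_eq_zero, not_le]
    positivity
  have hkey' : ENNReal.ofReal (X / 2) / ENNReal.ofReal (128 * D ^ 2 / X ^ 2) ≤ B := by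
    rw [ENNReal.div_le_iff hc ENNReal.ofReal_ne_top, mul_comm]
    exact hkey
  refine le_trans (le_of_eq ?_) hkey'
  rw [← ENNReal.ofReal_div_of_pos (by positivity)]
  congr 1
  field_simp
  ring

/--
info: 'Summit.NavierStokesRegularity.NavierStokesRegularity.Theorems.L3TimeExponentPincerWeakLayerCake.lintegral_cube_ge_of_weak' depends on axioms: [propext,
 Classical.choice,
 Quot.sound]
-/
#guard_msgs in
#print axioms lintegral_cube_ge_of_weak

end Summit.NavierStokesRegularity.NavierStokesRegularity.Theorems.L3TimeExponentPincerWeakLayerCake
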